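import Literature.Analysis.PDE.EvansKrylovJets
import Literature.Analysis.PDE.WeakHarnackSubball
import Literature.Analysis.PDE.MotzkinWasow
import Literature.Analysis.Calculus.MultilinearComponentBounds
import HarnessLib

/-!
# Evans–Krylov (17.46)–(17.48): calculus of the functions `h_k`, `w_k` and the polarisation bound

Auxiliary facts for `Literature/Analysis/PDE/EvansKrylovSupersolution.lean` (Gilbarg–Trudinger,
§17.4, the paragraph from (17.46) to (17.48): the functions `w_k = h_k + ε Σ_l h_l²` built from the
normalised pure second derivatives `h_k = ½(1 + D_{γ_kγ_k}u/(1 + M₂))` are supersolutions);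
everything here is proved.

* Hessian matrices (`ABP.hessianMatrix`) of sums, finite sums, squares and affine images of `C²`
  germs (`hessianMatrix_fun_add`, `hessianMatrix_fun_sum`, `hessianMatrix_sq`,
  `hessianMatrix_const_mul_add_const`) and the Hessian of `w_k = h_k + ε Σ_l h_l²`
  (`hessianMatrix_add_mul_sum_sq`), in the format of `EvansKrylov.pair_hessian_w_ge`;
* the pure second derivative `quadHess u γ` as a combination of components of `D²u`
  (`quadHess_eq_sum_iteratedFDeriv`), its smoothness (`contDiffAt_quadHess`), its derivative
  `∂_v D_{γγ}u = Σ γ_a γ_b D³u(v, e_a, e_b)` (`fderiv_quadHess_apply`) and the bound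
  `|D_{γγ}u(y)| ≤ ‖D²u(y)‖` for a unit `γ` (`abs_quadHess_le_norm_iteratedFDeriv`);
* **polarisation** (GT p. 459, "by our choice of `γ_k` we can estimate
  `|D³u|² ≤ 4(1+M₂)² Σ|Dh_k|²`"): an entry of a symmetric matrix is controlled by its quadratic
  form along the directions `e_a`, `(e_a ± e_b)/√2` (`sq_entry_le_sum_sq_quadForm`), whence
  `thirdSq u y ≤ n³ Σ_k Σ_i (∂_i D_{γ_kγ_k}u(y))²` (`thirdSq_le_card_pow_mul_sum`).

## References

* D. Gilbarg, N. S. Trudinger, *Elliptic Partial Differential Equations of Second Order* (2001),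
  §17.4, (17.46)–(17.48). [GilbargTrudinger2001]
-/

noncomputable section

open Matrix Finset Filter
open scoped Topology

namespace Literature.Analysis.PDE.EvansKrylov

open Literature.Analysis.Calculus Literature.Analysis.PDE.ABP
  Literature.Analysis.PDE.KrylovSafonov

/-! ### Hessian matrices of sums and squares of `C²` germs -/

section HessianCalculus

variable {E : Type*} [NormedAddCommGroup E] [InnerProductSpace ℝ E] {ι : Type*} [Fintype ι]
  {K : Type*}

omit [Fintype ι] in
/-- A `C²` germ is differentiable near the point and its derivative is differentiable at the
point (the hypotheses of `KrylovSafonov.hessianMatrix_const_mul` / `hessianMatrix_mul`).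
[folklore] -/
theorem differentiable_data_of_contDiffAt_two {f : E → ℝ} {x : E} (hf : ContDiffAt ℝ 2 f x) :
    (∀ᶠ y in 𝓝 x, DifferentiableAt ℝ f y) ∧ DifferentiableAt ℝ (fderiv ℝ f) x := by
  refine ⟨?_, (hf.fderiv_right (m := 1) (by norm_num)).differentiableAt (by norm_num)⟩
  filter_upwards [hf.eventually (by simp)] with y hy
  exact hy.differentiableAt (by norm_num)

/-- The Hessian matrix of a sum of two `C²` germs. [folklore] -/
theorem hessianMatrix_fun_add (b : OrthonormalBasis ι ℝ E) {f g : E → ℝ} {x : E}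
    (hf : ContDiffAt ℝ 2 f x) (hg : ContDiffAt ℝ 2 g x) :
    hessianMatrix (fun z ↦ f z + g z) b x = hessianMatrix f b x + hessianMatrix g b x := by
  obtain ⟨hf1, hf2⟩ := differentiable_data_of_contDiffAt_two hf
  obtain ⟨hg1, hg2⟩ := differentiable_data_of_contDiffAt_two hg
  have h1 : fderiv ℝ (fun z ↦ f z + g z) =ᶠ[𝓝 x] fun z ↦ fderiv ℝ f z + fderiv ℝ g z := by
    filter_upwards [hf1, hg1] with z hfz hgz
    exact fderiv_fun_add hfz hgz
  have h2 : HasFDerivAt (fderiv ℝ (fun z ↦ f z + g z))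
      (fderiv ℝ (fderiv ℝ f) x + fderiv ℝ (fderiv ℝ g) x) x :=
    (hf2.hasFDerivAt.add hg2.hasFDerivAt).congr_of_eventuallyEq h1
  ext i j
  rw [hessianMatrix_apply, h2.fderiv]
  simp [hessianMatrix_apply]

/-- The Hessian matrix of the zero function vanishes. [folklore] -/
theorem hessianMatrix_fun_zero (b : OrthonormalBasis ι ℝ E) (x : E) :
    hessianMatrix (fun _ : E ↦ (0 : ℝ)) b x = 0 := by
  ext i j
  simp [hessianMatrix_apply]

/-- The Hessian matrix of a finite sum of `C²` germs. [folklore] -/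
theorem hessianMatrix_fun_sum (b : OrthonormalBasis ι ℝ E) {f : K → E → ℝ} {x : E}
    (s : Finset K) (hf : ∀ k ∈ s, ContDiffAt ℝ 2 (f k) x) :
    hessianMatrix (fun z ↦ ∑ k ∈ s, f k z) b x = ∑ k ∈ s, hessianMatrix (f k) b x := by
  classical
  induction s using Finset.induction_on with
  | empty => simpa using hessianMatrix_fun_zero b x
  | insert k s hk ih =>
    have e : (fun z ↦ ∑ l ∈ insert k s, f l z) = fun z ↦ f k z + ∑ l ∈ s, f l z := by
      funext z; rw [Finset.sum_insert hk]
    rw [e, Finset.sum_insert hk, hessianMatrix_fun_add b (hf k (Finset.mem_insert_self k s))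
      (ContDiffAt.sum fun l hl ↦ hf l (Finset.mem_insert_of_mem hl)),
      ih fun l hl ↦ hf l (Finset.mem_insert_of_mem hl)]

/-- **The Hessian matrix of a square**: `H_{f²} = 2f H_f + 2 Df ⊗ Df` for a `C²` germ `f`.
[folklore] -/
theorem hessianMatrix_sq (b : OrthonormalBasis ι ℝ E) {f : E → ℝ} {x : E}
    (hf : ContDiffAt ℝ 2 f x) :
    hessianMatrix (fun z ↦ f z ^ 2) b x =
      (2 * f x) • hessianMatrix f b x +
        (2 : ℝ) • vecMulVec (fun i ↦ fderiv ℝ f x (b i)) (fun i ↦ fderiv ℝ f x (b i)) := by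
  obtain ⟨hf1, hf2⟩ := differentiable_data_of_contDiffAt_two hf
  have e : (fun z ↦ f z ^ 2) = fun z ↦ f z * f z := by funext z; ring
  rw [e, hessianMatrix_mul b (hf1.mono fun y hy ↦ ⟨hy, hy⟩) hf2 hf2]
  ext i j
  simp only [Matrix.add_apply, Matrix.smul_apply, vecMulVec_apply, smul_eq_mul]
  ring

/-- The Hessian matrix of an affine image `c f + d` of a `C²` germ is `c H_f`. [folklore] -/
theorem hessianMatrix_const_mul_add_const (b : OrthonormalBasis ι ℝ E) {f : E → ℝ} {x : E}
    (hf : ContDiffAt ℝ 2 f x) (c d : ℝ) :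
    hessianMatrix (fun z ↦ c * f z + d) b x = c • hessianMatrix f b x := by
  obtain ⟨hf1, hf2⟩ := differentiable_data_of_contDiffAt_two hf
  rw [hessianMatrix_add_const (fun z ↦ c * f z) d b x, hessianMatrix_const_mul b c hf1 hf2]

/-- **The Hessian matrix of `w_k = h_k + ε Σ_l h_l²`** for `C²` germs `h_l`:
`H_{w_k} = H_k + ε Σ_l (2 h_l H_l + 2 Dh_l ⊗ Dh_l)` — the format of `pair_hessian_w_ge`.
[cite: GilbargTrudinger2001, §17.4, (17.47)–(17.48)] -/
theorem hessianMatrix_add_mul_sum_sq [Fintype K] (b : OrthonormalBasis ι ℝ E) {h : K → E → ℝ}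
    {x : E} (hh : ∀ l, ContDiffAt ℝ 2 (h l) x) (ε : ℝ) (k : K) :
    hessianMatrix (fun z ↦ h k z + ε * ∑ l, h l z ^ 2) b x =
      hessianMatrix (h k) b x + ε • ∑ l, ((2 * h l x) • hessianMatrix (h l) b x +
        (2 : ℝ) • vecMulVec (fun i ↦ fderiv ℝ (h l) x (b i)) (fun i ↦ fderiv ℝ (h l) x (b i))) := by
  have hsq : ∀ l, ContDiffAt ℝ 2 (fun z ↦ h l z ^ 2) x := fun l ↦ (hh l).pow 2
  have hsum : ContDiffAt ℝ 2 (fun z ↦ ∑ l, h l z ^ 2) x := ContDiffAt.sum fun l _ ↦ hsq l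
  have hεsum : ContDiffAt ℝ 2 (fun z ↦ ε * ∑ l, h l z ^ 2) x := contDiffAt_const.mul hsum
  obtain ⟨hs1, hs2⟩ := differentiable_data_of_contDiffAt_two hsum
  rw [hessianMatrix_fun_add b (hh k) hεsum, hessianMatrix_const_mul b ε hs1 hs2,
    hessianMatrix_fun_sum b Finset.univ fun l _ ↦ hsq l,
    Finset.sum_congr rfl fun l _ ↦ hessianMatrix_sq b (hh l)]

end HessianCalculus

/-! ### The pure second derivatives `quadHess u γ` -/

section QuadHess

variable {ι : Type*} [Fintype ι] [DecidableEq ι]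

omit [DecidableEq ι] in
/-- `D_{γγ}u(x) = Σ_{a,b} γ_a γ_b D²u(x)(e_a, e_b)`. [folklore] -/
theorem quadHess_eq_sum_iteratedFDeriv (u : EuclideanSpace ℝ ι → ℝ) (γ : ι → ℝ)
    (x : EuclideanSpace ℝ ι) :
    quadHess u γ x = ∑ a, ∑ b, γ a * γ b *
      iteratedFDeriv ℝ 2 u x ![EuclideanSpace.basisFun ι ℝ a, EuclideanSpace.basisFun ι ℝ b] := by
  simp only [quadHess_eq, dotProduct, mulVec, hessianMatrix_apply, Finset.mul_sum,
    iteratedFDeriv_two_apply, Matrix.cons_val_zero, Matrix.cons_val_one]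
  exact Finset.sum_congr rfl fun a _ ↦ Finset.sum_congr rfl fun b _ ↦ by ring

omit [DecidableEq ι] in
/-- A component `z ↦ D²u(z)(M)` of the second derivative is `C²` where `u` is `C⁴`.
[folklore] -/
theorem contDiffAt_iteratedFDeriv_two_apply_const {u : EuclideanSpace ℝ ι → ℝ}
    {x : EuclideanSpace ℝ ι} (hu : ContDiffAt ℝ 4 u x) (M : Fin 2 → EuclideanSpace ℝ ι) :
    ContDiffAt ℝ 2 (fun z ↦ iteratedFDeriv ℝ 2 u z M) x :=
  (ContinuousMultilinearMap.apply ℝ (fun _ : Fin 2 ↦ EuclideanSpace ℝ ι) ℝ M).contDiff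
    |>.comp_contDiffAt x (hu.iteratedFDeriv_right (i := 2) (m := 2) (by norm_num))

omit [DecidableEq ι] in
/-- `D_{γγ}u` is `C²` at a point where `u` is `C⁴`. [folklore] -/
theorem contDiffAt_quadHess {u : EuclideanSpace ℝ ι → ℝ} {x : EuclideanSpace ℝ ι}
    (hu : ContDiffAt ℝ 4 u x) (γ : ι → ℝ) : ContDiffAt ℝ 2 (quadHess u γ) x := by
  have e : quadHess u γ = fun z ↦ ∑ a, ∑ b, γ a * γ b *
      iteratedFDeriv ℝ 2 u z ![EuclideanSpace.basisFun ι ℝ a, EuclideanSpace.basisFun ι ℝ b] := by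
    funext z; exact quadHess_eq_sum_iteratedFDeriv u γ z
  rw [e]
  exact ContDiffAt.sum fun a _ ↦ ContDiffAt.sum fun b _ ↦
    contDiffAt_const.mul (contDiffAt_iteratedFDeriv_two_apply_const hu _)

omit [DecidableEq ι] in
/-- **The derivative of a pure second derivative**:
`∂_v D_{γγ}u (y) = Σ_{a,b} γ_a γ_b D³u(y)(v, e_a, e_b)` for `u` of class `C³` at `y`.
[folklore] -/
theorem fderiv_quadHess_apply {u : EuclideanSpace ℝ ι → ℝ} {y : EuclideanSpace ℝ ι}
    (hu : ContDiffAt ℝ 3 u y) (γ : ι → ℝ) (v : EuclideanSpace ℝ ι) :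
    fderiv ℝ (quadHess u γ) y v = ∑ a, ∑ b, γ a * γ b *
      iteratedFDeriv ℝ 3 u y
        ![v, EuclideanSpace.basisFun ι ℝ a, EuclideanSpace.basisFun ι ℝ b] := by
  have e : quadHess u γ = fun z ↦ ∑ a, ∑ b, γ a * γ b *
      iteratedFDeriv ℝ 2 u z ![EuclideanSpace.basisFun ι ℝ a, EuclideanSpace.basisFun ι ℝ b] := by
    funext z; exact quadHess_eq_sum_iteratedFDeriv u γ z
  have hd : ∀ M : Fin 2 → EuclideanSpace ℝ ι,
      DifferentiableAt ℝ (fun z ↦ iteratedFDeriv ℝ 2 u z M) y := fun M ↦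
    (hu.differentiableAt_iteratedFDeriv (by norm_num)).continuousMultilinear_apply_const M
  have hD : HasFDerivAt (quadHess u γ) (∑ a, ∑ b, (γ a * γ b) •
      fderiv ℝ (fun z ↦ iteratedFDeriv ℝ 2 u z
        ![EuclideanSpace.basisFun ι ℝ a, EuclideanSpace.basisFun ι ℝ b]) y) y := by
    rw [e]
    exact HasFDerivAt.fun_sum fun a _ ↦ HasFDerivAt.fun_sum fun b _ ↦
      (hd _).hasFDerivAt.const_mul (γ a * γ b)
  rw [hD.fderiv]
  simp only [FunLike.coe_sum, Finset.sum_apply, FunLike.coe_smul, Pi.smul_apply, smul_eq_mul]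
  refine Finset.sum_congr rfl fun a _ ↦ Finset.sum_congr rfl fun b _ ↦ ?_
  rw [fderiv_iteratedFDeriv_apply_const hu]
  rfl

omit [DecidableEq ι] in
/-- **`|D_{γγ}u(y)| ≤ ‖D²u(y)‖` for a unit coordinate vector `γ`**: `D_{γγ}u(y) = D²u(y)(γ̂, γ̂)`
with `γ̂ = Σ γ_i e_i`, `‖γ̂‖ = 1`. [folklore] -/
theorem abs_quadHess_le_norm_iteratedFDeriv (u : EuclideanSpace ℝ ι → ℝ) (y : EuclideanSpace ℝ ι)
    {γ : ι → ℝ} (hγ : γ ⬝ᵥ γ = 1) : |quadHess u γ y| ≤ ‖iteratedFDeriv ℝ 2 u y‖ := by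
  set v : EuclideanSpace ℝ ι := ∑ i, γ i • EuclideanSpace.basisFun ι ℝ i with hv
  have hvn : ‖v‖ * ‖v‖ = 1 := by
    rw [← real_inner_self_eq_norm_mul_norm, hv,
      (EuclideanSpace.basisFun ι ℝ).orthonormal.inner_sum γ γ Finset.univ]
    simpa [dotProduct] using hγ
  have e : quadHess u γ y = iteratedFDeriv ℝ 2 u y ![v, v] := by
    rw [quadHess_eq, dotProduct_hessianMatrix_mulVec, iteratedFDeriv_two_apply, ← hv]
    rfl
  rw [e, ← Real.norm_eq_abs]
  calc ‖iteratedFDeriv ℝ 2 u y ![v, v]‖ ≤ ‖iteratedFDeriv ℝ 2 u y‖ * ∏ i, ‖![v, v] i‖ :=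
        ContinuousMultilinearMap.le_opNorm _ _
    _ = ‖iteratedFDeriv ℝ 2 u y‖ := by
        rw [Fin.prod_univ_two, Matrix.cons_val_zero, Matrix.cons_val_one,
          Matrix.cons_val_fin_one, hvn, mul_one]

end QuadHess

/-! ### Polarisation: the third derivatives are controlled by the gradients of the `h_k` -/

section Polarisation

variable {ι : Type*} [Fintype ι] [DecidableEq ι] {Kt : Type*} [Fintype Kt]

/-- **Polarisation bound.** For a symmetric matrix `T` and a family of vectors `γ_k` containing
every `e_a` and every `(e_a ± e_b)/√2` (`a ≠ b`), each entry satisfies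
`(T a b)² ≤ Σ_k (γ_kᵀ T γ_k)²` (`diag_entry_eq`, `entry_eq_half_diag_sub`). [folklore] -/
theorem sq_entry_le_sum_sq_quadForm (T : Matrix ι ι ℝ) (hT : T.IsSymm) {γ : Kt → ι → ℝ}
    (hdiag : ∀ i, ∃ k, γ k = Pi.single i 1)
    (hoff : ∀ i j, i ≠ j →
      (∃ k, γ k = (Real.sqrt 2)⁻¹ • (Pi.single i 1 + Pi.single j 1)) ∧
      (∃ k, γ k = (Real.sqrt 2)⁻¹ • (Pi.single i 1 - Pi.single j 1)))
    (a b : ι) : (T a b) ^ 2 ≤ ∑ k, (γ k ⬝ᵥ (T *ᵥ γ k)) ^ 2 := by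
  have hle : ∀ k, (γ k ⬝ᵥ (T *ᵥ γ k)) ^ 2 ≤ ∑ l, (γ l ⬝ᵥ (T *ᵥ γ l)) ^ 2 := fun k ↦
    Finset.single_le_sum (f := fun l ↦ (γ l ⬝ᵥ (T *ᵥ γ l)) ^ 2) (fun l _ ↦ sq_nonneg _)
      (Finset.mem_univ k)
  by_cases hab : a = b
  · subst hab
    obtain ⟨k, hk⟩ := hdiag a
    have e : T a a = γ k ⬝ᵥ (T *ᵥ γ k) := by rw [hk]; exact diag_entry_eq ι T a
    rw [e]
    exact hle k
  · obtain ⟨⟨kp, hkp⟩, ⟨km, hkm⟩⟩ := hoff a b hab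
    have e : T a b = (γ kp ⬝ᵥ (T *ᵥ γ kp) - γ km ⬝ᵥ (T *ᵥ γ km)) / 2 := by
      rw [hkp, hkm]; exact entry_eq_half_diag_sub ι T hT hab
    rw [e]
    have h1 := hle kp
    have h2 := hle km
    nlinarith [sq_nonneg (γ kp ⬝ᵥ (T *ᵥ γ kp) + γ km ⬝ᵥ (T *ᵥ γ km))]

/-- **Motzkin–Wasow control of the third derivatives** (Gilbarg–Trudinger p. 459: "by our
choice of `γ_k` we can estimate `|D³u|² ≤ 4(1+M₂)² Σ_k |Dh_k|²`"): if the unit coordinate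
vectors `γ_k` contain every `e_a` and every `(e_a ± e_b)/√2`, then
`thirdSq u y ≤ n³ Σ_k Σ_i (∂_i D_{γ_kγ_k}u(y))²` for `u` of class `C³` at `y` (symmetry of
`D³u(y)` and polarisation in the last two slots).
[cite: GilbargTrudinger2001, §17.4, proof of (17.48)] -/
theorem thirdSq_le_card_pow_mul_sum {u : EuclideanSpace ℝ ι → ℝ} {y : EuclideanSpace ℝ ι}
    (hu : ContDiffAt ℝ 3 u y) {γ : Kt → ι → ℝ} (hdiag : ∀ i, ∃ k, γ k = Pi.single i 1)
    (hoff : ∀ i j, i ≠ j →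
      (∃ k, γ k = (Real.sqrt 2)⁻¹ • (Pi.single i 1 + Pi.single j 1)) ∧
      (∃ k, γ k = (Real.sqrt 2)⁻¹ • (Pi.single i 1 - Pi.single j 1))) :
    thirdSq u y ≤ (Fintype.card ι : ℝ) ^ 3 *
      ∑ k, ∑ i, (fderiv ℝ (quadHess u (γ k)) y (EuclideanSpace.basisFun ι ℝ i)) ^ 2 := by
  set bE := EuclideanSpace.basisFun ι ℝ
  -- the symmetric matrices `T i = (D³u(y)(e_i, e_a, e_b))_{ab}`
  set T : ι → Matrix ι ι ℝ := fun i ↦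
    Matrix.of fun a b ↦ iteratedFDeriv ℝ 3 u y ![bE i, bE a, bE b] with hT
  have hTs : ∀ i, (T i).IsSymm := fun i ↦ Matrix.IsSymm.ext fun a b ↦ by
    show iteratedFDeriv ℝ 3 u y ![bE i, bE b, bE a] = iteratedFDeriv ℝ 3 u y ![bE i, bE a, bE b]
    rw [← iteratedFDeriv_apply_perm_of_le hu (m := 3) (by norm_num) ![bE i, bE a, bE b]
      (Equiv.swap 1 2)]
    congr 1
    funext m
    fin_cases m <;> rfl
  have hq : ∀ k i, fderiv ℝ (quadHess u (γ k)) y (bE i) = γ k ⬝ᵥ (T i *ᵥ γ k) := fun k i ↦ by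
    rw [fderiv_quadHess_apply hu]
    simp only [hT, dotProduct, mulVec, Matrix.of_apply, Finset.mul_sum]
    exact Finset.sum_congr rfl fun a _ ↦ Finset.sum_congr rfl fun b _ ↦ by ring
  set S := ∑ k, ∑ i, (fderiv ℝ (quadHess u (γ k)) y (bE i)) ^ 2
  have hterm : ∀ I : Fin 3 → ι, (iteratedFDeriv ℝ 3 u y (fun m ↦ bE (I m))) ^ 2 ≤ S := fun I ↦ by
    have e : (fun m ↦ bE (I m)) = ![bE (I 0), bE (I 1), bE (I 2)] := by
      funext m; fin_cases m <;> rfl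
    have h1 : (T (I 0) (I 1) (I 2)) ^ 2 ≤ ∑ k, (γ k ⬝ᵥ (T (I 0) *ᵥ γ k)) ^ 2 :=
      sq_entry_le_sum_sq_quadForm (T (I 0)) (hTs (I 0)) hdiag hoff (I 1) (I 2)
    have h2 : ∑ k, (γ k ⬝ᵥ (T (I 0) *ᵥ γ k)) ^ 2 ≤ S := by
      refine Finset.sum_le_sum fun k _ ↦ ?_
      rw [← hq k (I 0)]
      exact Finset.single_le_sum (f := fun i ↦ (fderiv ℝ (quadHess u (γ k)) y (bE i)) ^ 2)
        (fun i _ ↦ sq_nonneg _) (Finset.mem_univ (I 0))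
    rw [e]
    exact h1.trans h2
  calc thirdSq u y = ∑ I : Fin 3 → ι, (iteratedFDeriv ℝ 3 u y (fun m ↦ bE (I m))) ^ 2 :=
        thirdSq_eq u y
    _ ≤ ∑ _I : Fin 3 → ι, S := Finset.sum_le_sum fun I _ ↦ hterm I
    _ = (Fintype.card ι : ℝ) ^ 3 * S := by
        rw [Finset.sum_const, Finset.card_univ, Fintype.card_fun, Fintype.card_fin, nsmul_eq_mul]
        push_cast
        ring

end Polarisation

end Literature.Analysis.PDE.EvansKrylov

end
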